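import Mathlib
import Summits.KontsevichZagierPeriods.KontsevichZagierPeriods.Theses.SymplecticScissors
import Literature.NumberTheory.Transcendental.KZCalculusProofs

/-!
# `VolumeForm` (stmt-KontsevichZagierPeriods-3814), line `Sketch` — stub `stub_stackUnionSector`

The SECTOR THEOREM for ruled stacks with polygonal sections (finite disjoint unions of triangular
stacks in `ℝ³`), as pure glue. Hypotheses: (i) *stack-union reduction* — every finite pairwise
disjoint union `r` of `k` triangular stacks over the same parameter interval `(a, b)` (each stack
the solid swept by an open non-degenerate triangle whose three vertices are `ℚ`-semialgebraic `C¹`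
curves of `t ∈ (a, b)`, integrand `1`) is KZ-equivalent to an integrand-`1` planar representation
`s` on the subgraph `{(t, y) | a < t < b, 0 < y < ∑ᵢ |det Mᵢ(t)| / 2}` of half the sum of its
slice determinants, and such an `s` exists; (ii) the planar layer `PlanarAreas` (stmt-4990): two
planar integrand-`1` representations with the same value are KZ-equivalent. Conclusion: two such
unions of equal volume are KZ-equivalent.

Proof: reduce both unions `r ↝ s`, `r' ↝ s'`; by soundness of the calculus
(`KZ.Equivalent.value_eq_holds`) `s.value = r.value = r'.value = s'.value`, so `s ∼ s'` by
`PlanarAreas`, and `r ∼ s ∼ s' ∼ r'` by transitivity/symmetry of `KZ.Equivalent`.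

Sources: M. Kontsevich, D. Zagier, *Periods* (2001), §1.2 (rules (1)–(3), soundness); the rest is
bookkeeping (folklore).
-/

noncomputable section

open scoped BigOperators
open Set MeasureTheory
open Literature.NumberTheory.Transcendental

namespace Summit.KontsevichZagierPeriods.SymplecticScissors.VolumeForm

open Summit.KontsevichZagierPeriods.KontsevichZagierPeriods.Theses.SymplecticScissors (PlanarAreas)

/-- **Stack-union sector** (glue): given stack-union reduction (a finite disjoint union of
triangular stacks is KZ-equivalent to the integrand-`1` planar subgraph of `∑ᵢ |det Mᵢ(t)| / 2`)
and the planar layer `PlanarAreas` (stmt-4990), two finite disjoint unions of triangular stacks of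
equal volume are KZ-equivalent (reduce both, compare the two planar subgraphs by `PlanarAreas` —
their values agree by soundness `KZ.Equivalent.value_eq_holds` — and chain by transitivity).
[Kontsevich–Zagier 2001, §1.2; folklore] -/
theorem stub_stackUnionSector :
    (∀ (k : ℕ) (a b : ℝ) (V : Fin k → Fin 3 → ℝ → Fin 2 → ℝ) (r : KZ.IntegralRep 3),
      a < b →
      (∀ i j, IsSemialgebraicMapOn ℚ {z : Fin 1 → ℝ | z 0 ∈ Set.Ioo a b} (fun z => V i j (z 0))) →
      (∀ i j, ContDiffOn ℝ 1 (V i j) (Set.Ioo a b)) →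
      (∀ i, ∀ t ∈ Set.Ioo a b, (V i 1 t 0 - V i 0 t 0) * (V i 2 t 1 - V i 0 t 1)
        - (V i 1 t 1 - V i 0 t 1) * (V i 2 t 0 - V i 0 t 0) ≠ 0) →
      (∀ i i', i ≠ i' → Disjoint
        {p : Fin 3 → ℝ | p 0 ∈ Set.Ioo a b ∧ ∃ l m : ℝ, 0 < l ∧ 0 < m ∧ l + m < 1 ∧
          p 1 = V i 0 (p 0) 0 + l * (V i 1 (p 0) 0 - V i 0 (p 0) 0) + m * (V i 2 (p 0) 0 - V i 0 (p 0) 0) ∧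
          p 2 = V i 0 (p 0) 1 + l * (V i 1 (p 0) 1 - V i 0 (p 0) 1) + m * (V i 2 (p 0) 1 - V i 0 (p 0) 1)}
        {p : Fin 3 → ℝ | p 0 ∈ Set.Ioo a b ∧ ∃ l m : ℝ, 0 < l ∧ 0 < m ∧ l + m < 1 ∧
          p 1 = V i' 0 (p 0) 0 + l * (V i' 1 (p 0) 0 - V i' 0 (p 0) 0) + m * (V i' 2 (p 0) 0 - V i' 0 (p 0) 0) ∧
          p 2 = V i' 0 (p 0) 1 + l * (V i' 1 (p 0) 1 - V i' 0 (p 0) 1) + m * (V i' 2 (p 0) 1 - V i' 0 (p 0) 1)}) →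
      r.domain = ⋃ i, {p : Fin 3 → ℝ | p 0 ∈ Set.Ioo a b ∧ ∃ l m : ℝ, 0 < l ∧ 0 < m ∧ l + m < 1 ∧
          p 1 = V i 0 (p 0) 0 + l * (V i 1 (p 0) 0 - V i 0 (p 0) 0) + m * (V i 2 (p 0) 0 - V i 0 (p 0) 0) ∧
          p 2 = V i 0 (p 0) 1 + l * (V i 1 (p 0) 1 - V i 0 (p 0) 1) + m * (V i 2 (p 0) 1 - V i 0 (p 0) 1)} →
      (∀ p ∈ r.domain, r.integrand p = 1) →
      ∃ s : KZ.IntegralRep 2,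
        s.domain = {q | q 0 ∈ Set.Ioo a b ∧ 0 < q 1 ∧
          q 1 < ∑ i, |(V i 1 (q 0) 0 - V i 0 (q 0) 0) * (V i 2 (q 0) 1 - V i 0 (q 0) 1)
            - (V i 1 (q 0) 1 - V i 0 (q 0) 1) * (V i 2 (q 0) 0 - V i 0 (q 0) 0)| / 2} ∧
        (∀ q ∈ s.domain, s.integrand q = 1) ∧ KZ.Equivalent r s) →
    PlanarAreas →
    ∀ (k : ℕ) (a b : ℝ) (V : Fin k → Fin 3 → ℝ → Fin 2 → ℝ) (k' : ℕ) (a' b' : ℝ)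
      (V' : Fin k' → Fin 3 → ℝ → Fin 2 → ℝ) (r r' : KZ.IntegralRep 3),
      a < b →
      (∀ i j, IsSemialgebraicMapOn ℚ {z : Fin 1 → ℝ | z 0 ∈ Set.Ioo a b} (fun z => V i j (z 0))) →
      (∀ i j, ContDiffOn ℝ 1 (V i j) (Set.Ioo a b)) →
      (∀ i, ∀ t ∈ Set.Ioo a b, (V i 1 t 0 - V i 0 t 0) * (V i 2 t 1 - V i 0 t 1)
        - (V i 1 t 1 - V i 0 t 1) * (V i 2 t 0 - V i 0 t 0) ≠ 0) →
      (∀ i i', i ≠ i' → Disjoint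
        {p : Fin 3 → ℝ | p 0 ∈ Set.Ioo a b ∧ ∃ l m : ℝ, 0 < l ∧ 0 < m ∧ l + m < 1 ∧
          p 1 = V i 0 (p 0) 0 + l * (V i 1 (p 0) 0 - V i 0 (p 0) 0) + m * (V i 2 (p 0) 0 - V i 0 (p 0) 0) ∧
          p 2 = V i 0 (p 0) 1 + l * (V i 1 (p 0) 1 - V i 0 (p 0) 1) + m * (V i 2 (p 0) 1 - V i 0 (p 0) 1)}
        {p : Fin 3 → ℝ | p 0 ∈ Set.Ioo a b ∧ ∃ l m : ℝ, 0 < l ∧ 0 < m ∧ l + m < 1 ∧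
          p 1 = V i' 0 (p 0) 0 + l * (V i' 1 (p 0) 0 - V i' 0 (p 0) 0) + m * (V i' 2 (p 0) 0 - V i' 0 (p 0) 0) ∧
          p 2 = V i' 0 (p 0) 1 + l * (V i' 1 (p 0) 1 - V i' 0 (p 0) 1) + m * (V i' 2 (p 0) 1 - V i' 0 (p 0) 1)}) →
      r.domain = ⋃ i, {p : Fin 3 → ℝ | p 0 ∈ Set.Ioo a b ∧ ∃ l m : ℝ, 0 < l ∧ 0 < m ∧ l + m < 1 ∧
          p 1 = V i 0 (p 0) 0 + l * (V i 1 (p 0) 0 - V i 0 (p 0) 0) + m * (V i 2 (p 0) 0 - V i 0 (p 0) 0) ∧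
          p 2 = V i 0 (p 0) 1 + l * (V i 1 (p 0) 1 - V i 0 (p 0) 1) + m * (V i 2 (p 0) 1 - V i 0 (p 0) 1)} →
      (∀ p ∈ r.domain, r.integrand p = 1) →
      a' < b' →
      (∀ i j, IsSemialgebraicMapOn ℚ {z : Fin 1 → ℝ | z 0 ∈ Set.Ioo a' b'} (fun z => V' i j (z 0))) →
      (∀ i j, ContDiffOn ℝ 1 (V' i j) (Set.Ioo a' b')) →
      (∀ i, ∀ t ∈ Set.Ioo a' b', (V' i 1 t 0 - V' i 0 t 0) * (V' i 2 t 1 - V' i 0 t 1)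
        - (V' i 1 t 1 - V' i 0 t 1) * (V' i 2 t 0 - V' i 0 t 0) ≠ 0) →
      (∀ i i', i ≠ i' → Disjoint
        {p : Fin 3 → ℝ | p 0 ∈ Set.Ioo a' b' ∧ ∃ l m : ℝ, 0 < l ∧ 0 < m ∧ l + m < 1 ∧
          p 1 = V' i 0 (p 0) 0 + l * (V' i 1 (p 0) 0 - V' i 0 (p 0) 0) + m * (V' i 2 (p 0) 0 - V' i 0 (p 0) 0) ∧
          p 2 = V' i 0 (p 0) 1 + l * (V' i 1 (p 0) 1 - V' i 0 (p 0) 1) + m * (V' i 2 (p 0) 1 - V' i 0 (p 0) 1)}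
        {p : Fin 3 → ℝ | p 0 ∈ Set.Ioo a' b' ∧ ∃ l m : ℝ, 0 < l ∧ 0 < m ∧ l + m < 1 ∧
          p 1 = V' i' 0 (p 0) 0 + l * (V' i' 1 (p 0) 0 - V' i' 0 (p 0) 0) +
            m * (V' i' 2 (p 0) 0 - V' i' 0 (p 0) 0) ∧
          p 2 = V' i' 0 (p 0) 1 + l * (V' i' 1 (p 0) 1 - V' i' 0 (p 0) 1) +
            m * (V' i' 2 (p 0) 1 - V' i' 0 (p 0) 1)}) →
      r'.domain = ⋃ i, {p : Fin 3 → ℝ | p 0 ∈ Set.Ioo a' b' ∧ ∃ l m : ℝ, 0 < l ∧ 0 < m ∧ l + m < 1 ∧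
          p 1 = V' i 0 (p 0) 0 + l * (V' i 1 (p 0) 0 - V' i 0 (p 0) 0) + m * (V' i 2 (p 0) 0 - V' i 0 (p 0) 0) ∧
          p 2 = V' i 0 (p 0) 1 + l * (V' i 1 (p 0) 1 - V' i 0 (p 0) 1) + m * (V' i 2 (p 0) 1 - V' i 0 (p 0) 1)} →
      (∀ p ∈ r'.domain, r'.integrand p = 1) →
      r.value = r'.value → KZ.Equivalent r r' := by
  intro hSR hP k a b V k' a' b' V' r r' hab hsa hc hdet hdisj hdom h1 hab' hsa' hc' hdet' hdisj'
    hdom' h1' hv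
  obtain ⟨s, _hsd, hs1, hrs⟩ := hSR k a b V r hab hsa hc hdet hdisj hdom h1
  obtain ⟨s', _hsd', hs1', hrs'⟩ := hSR k' a' b' V' r' hab' hsa' hc' hdet' hdisj' hdom' h1'
  have hrsv : r.value = s.value := KZ.Equivalent.value_eq_holds hrs
  have hrsv' : r'.value = s'.value := KZ.Equivalent.value_eq_holds hrs'
  have hsv : s.value = s'.value := by rw [← hrsv, ← hrsv', hv]
  have hss' : KZ.Equivalent s s' := hP s s' hs1 hs1' hsv
  exact hrs.trans (hss'.trans hrs'.symm)

end Summit.KontsevichZagierPeriods.SymplecticScissors.VolumeForm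

end
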